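import Mathlib
import HarnessLib
import Summits.AtomisticToContinuum.Crystallization.Theorems.PricedLinkCensusSoftLayerPropagationOneStackingMapSearchDefs
import Summits.AtomisticToContinuum.Crystallization.Theorems.PricedLinkCensusSoftLayerPropagationOneStackingMapSearchLeaf
import Summits.AtomisticToContinuum.Crystallization.Theorems.PricedLinkCensusSoftLayerPropagationOneStackingMapSearchBasic
import Summits.AtomisticToContinuum.Crystallization.Theorems.PricedLinkCensusSoftLayerPropagationOneStackingMapRealizes
import Summits.AtomisticToContinuum.Crystallization.Theorems.PricedLinkCensusSoftLayerPropagationOneStackingMapStep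
import Summits.AtomisticToContinuum.Crystallization.Theorems.PricedLinkCensusSoftLayerPropagationOneStackingMapSearchSound
import Summits.AtomisticToContinuum.Crystallization.Theorems.PricedLinkCensusSoftLayerPropagationOneStackingMapDev
import Summits.AtomisticToContinuum.Crystallization.Theorems.PricedLinkCensusSoftLayerPropagationRealBallCoverDefs

/-!
# `stub_realBall` (crux `SoftLayerPropagation`, line `Sketch` v7): soundness of the octree cover
# check

Route `PricedLinkCensus`, crux `SoftLayerPropagation` (stmt-AtomisticToContinuum-14233), line
`Sketch`, registered stub `stub_realBall`.  Soundness of `…RealBallCoverDefs.lean`: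

* box geometry over `ℝ` (a real point `x` lies in the integer box `bl + [0, size]³` when its
  `S`-scaled coordinates do): the farthest-corner bound `S² ‖x - toE3 p‖² ≤ distSqFar p bl size`
  (`norm_sub_toE3_sq_le`), the origin bound `boxDistSq bl size ≤ S² ‖x‖²` (`boxDistSq_le`), and
  the eight halves cover the box (`exists_mem_kids`);
* `coverBox_sound` (induction on the depth; the thinning of the point list only shrinks it),
  `coverCheck_sound` (the shadow `63/20`-ball lies in the root box);
* `searchCover_sound`, `partsCover_sound` — the cover search visits the same tree as `St.search`
  (`options_sound` at inner nodes, `frontier_sound` for the parts), and at a leaf every site of a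
  realized state is a graph-`5`-ball site at its recorded shadow position (`RealizedBy.posE`,
  `lvlE`, `lvl5`), so a passing cover check gives: every `x` with `‖x‖² ≤ 2 (63/20)²` (shadow
  frame, `nn² = 2`) is within `δ √2` of the shadow of a graph-`5`-ball site of shadow radius
  `≤ R √2` (`1600 δ² = dN`, `100 R² = Rk`).

Finally `Hyp.cover_of_parts` transports the cover conclusion of the development `H.dev` of the
stub's hypotheses (`…OneStackingMapDev.lean`) back to the shadow space of `D`: every `x` with
`‖x - D i‖ ≤ 63/20` is within `δ` of `D v` for a graph-`5`-ball site `v` with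
`dist (D v) (D i) ≤ R`.  All [folklore] bookkeeping.
-/

noncomputable section

namespace Summit.AtomisticToContinuum.Crystallization.Theorems

namespace OneStacking

open V3 St

/-! ### Box geometry over `ℝ` -/

/-- On one axis: a real coordinate in `[l, l + size]` is within `farAxis pc l size` of the
integer `pc`. [folklore] -/
theorem sq_sub_le_farAxis_sq {X : ℝ} {l size : ℤ} (hl : (l : ℝ) ≤ X) (hu : X ≤ l + size) (pc : ℤ) :
    (X - pc) ^ 2 ≤ ((farAxis pc l size : ℤ) : ℝ) ^ 2 := by
  have hcast : ((farAxis pc l size : ℤ) : ℝ) = max |(l : ℝ) - pc| |(l : ℝ) + size - pc| := by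
    simp only [farAxis, Int.natCast_natAbs, Int.cast_max, Int.cast_abs, Int.cast_sub, Int.cast_add]
  rw [hcast]
  set M := max |(l : ℝ) - pc| |(l : ℝ) + size - pc| with hM
  have h1 : X - pc ≤ M :=
    le_trans (by linarith) ((le_abs_self ((l : ℝ) + size - pc)).trans (le_max_right _ _))
  have hA : -((l : ℝ) - pc) ≤ |(l : ℝ) - pc| := neg_le_abs _
  have h2 : pc - X ≤ M := le_trans (by linarith) (hA.trans (le_max_left _ _))
  have habs : |X - pc| ≤ M := abs_sub_le_iff.2 ⟨h1, h2⟩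
  calc (X - pc) ^ 2 = |X - pc| ^ 2 := (sq_abs _).symm
    _ ≤ M ^ 2 := pow_le_pow_left₀ (abs_nonneg _) habs 2

/-- On one axis: a real coordinate in `[l, l + size]` has modulus at least `nearAxis l size`.
[folklore] -/
theorem nearAxis_sq_le {X : ℝ} {l size : ℤ} (hl : (l : ℝ) ≤ X) (hu : X ≤ l + size) :
    ((nearAxis l size : ℤ) : ℝ) ^ 2 ≤ X ^ 2 := by
  unfold nearAxis
  split_ifs with h1 h2
  · have : (0 : ℝ) < l := by exact_mod_cast h1
    nlinarith
  · have : ((l + size : ℤ) : ℝ) < 0 := by exact_mod_cast h2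
    push_cast at this ⊢
    nlinarith
  · simp [sq_nonneg]

/-- **Farthest-corner bound**: a real point of the box `bl + [0, size]³` (in `S`-scaled
coordinates) is within `√(distSqFar p bl size) / S` of `toE3 p`. [folklore] -/
theorem norm_sub_toE3_sq_le {x : E3} {bl : V3} {size : ℤ}
    (hx : ((bl.x : ℝ) ≤ S * x 0 ∧ (S : ℝ) * x 0 ≤ bl.x + size) ∧
      ((bl.y : ℝ) ≤ S * x 1 ∧ (S : ℝ) * x 1 ≤ bl.y + size) ∧
      ((bl.z : ℝ) ≤ S * x 2 ∧ (S : ℝ) * x 2 ≤ bl.z + size)) (p : V3) :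
    (S : ℝ) ^ 2 * ‖x - toE3 p‖ ^ 2 ≤ (distSqFar p bl size : ℝ) := by
  obtain ⟨⟨h0l, h0u⟩, ⟨h1l, h1u⟩, ⟨h2l, h2u⟩⟩ := hx
  have hS := S_real.1
  have e : (S : ℝ) ^ 2 * ‖x - toE3 p‖ ^ 2 =
      ((S : ℝ) * x 0 - p.x) ^ 2 + ((S : ℝ) * x 1 - p.y) ^ 2 + ((S : ℝ) * x 2 - p.z) ^ 2 := by
    rw [EuclideanSpace.real_norm_sq_eq, Fin.sum_univ_three]
    simp only [PiLp.sub_apply, toE3_apply, Matrix.cons_val_zero, Matrix.cons_val_one,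
      Matrix.head_cons, Matrix.cons_val_two, Matrix.tail_cons]
    field_simp
  rw [e, distSqFar]
  push_cast
  have a0 := sq_sub_le_farAxis_sq h0l h0u p.x
  have a1 := sq_sub_le_farAxis_sq h1l h1u p.y
  have a2 := sq_sub_le_farAxis_sq h2l h2u p.z
  linarith

/-- **Origin bound**: a real point of the box has `S² ‖x‖² ≥ boxDistSq bl size`. [folklore] -/
theorem boxDistSq_le {x : E3} {bl : V3} {size : ℤ}
    (hx : ((bl.x : ℝ) ≤ S * x 0 ∧ (S : ℝ) * x 0 ≤ bl.x + size) ∧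
      ((bl.y : ℝ) ≤ S * x 1 ∧ (S : ℝ) * x 1 ≤ bl.y + size) ∧
      ((bl.z : ℝ) ≤ S * x 2 ∧ (S : ℝ) * x 2 ≤ bl.z + size)) :
    (boxDistSq bl size : ℝ) ≤ (S : ℝ) ^ 2 * ‖x‖ ^ 2 := by
  obtain ⟨⟨h0l, h0u⟩, ⟨h1l, h1u⟩, ⟨h2l, h2u⟩⟩ := hx
  have e : (S : ℝ) ^ 2 * ‖x‖ ^ 2 = ((S : ℝ) * x 0) ^ 2 + ((S : ℝ) * x 1) ^ 2 + ((S : ℝ) * x 2) ^ 2 := by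
    rw [EuclideanSpace.real_norm_sq_eq, Fin.sum_univ_three]; ring
  rw [e, boxDistSq]
  push_cast
  have a0 := nearAxis_sq_le h0l h0u
  have a1 := nearAxis_sq_le h1l h1u
  have a2 := nearAxis_sq_le h2l h2u
  linarith

/-- **The eight halves cover the box.** [folklore] -/
theorem exists_mem_kids {x : E3} {bl : V3} {h : ℤ}
    (hx : ((bl.x : ℝ) ≤ S * x 0 ∧ (S : ℝ) * x 0 ≤ bl.x + (2 * h : ℤ)) ∧
      ((bl.y : ℝ) ≤ S * x 1 ∧ (S : ℝ) * x 1 ≤ bl.y + (2 * h : ℤ)) ∧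
      ((bl.z : ℝ) ≤ S * x 2 ∧ (S : ℝ) * x 2 ≤ bl.z + (2 * h : ℤ))) :
    ∃ c ∈ kids bl h, ((c.x : ℝ) ≤ S * x 0 ∧ (S : ℝ) * x 0 ≤ c.x + h) ∧
      ((c.y : ℝ) ≤ S * x 1 ∧ (S : ℝ) * x 1 ≤ c.y + h) ∧
      ((c.z : ℝ) ≤ S * x 2 ∧ (S : ℝ) * x 2 ≤ c.z + h) := by
  obtain ⟨⟨h0l, h0u⟩, ⟨h1l, h1u⟩, ⟨h2l, h2u⟩⟩ := hx
  push_cast at h0u h1u h2u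
  rcases le_total ((S : ℝ) * x 0) (bl.x + h) with a0 | a0 <;>
  rcases le_total ((S : ℝ) * x 1) (bl.y + h) with a1 | a1 <;>
  rcases le_total ((S : ℝ) * x 2) (bl.z + h) with a2 | a2
  · exact ⟨⟨bl.x, bl.y, bl.z⟩, by simp [kids], ⟨h0l, a0⟩, ⟨h1l, a1⟩, ⟨h2l, a2⟩⟩
  · exact ⟨⟨bl.x, bl.y, bl.z + h⟩, by simp [kids], ⟨h0l, a0⟩, ⟨h1l, a1⟩,
      ⟨by push_cast; linarith, by push_cast; linarith⟩⟩
  · exact ⟨⟨bl.x, bl.y + h, bl.z⟩, by simp [kids], ⟨h0l, a0⟩,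
      ⟨by push_cast; linarith, by push_cast; linarith⟩, ⟨h2l, a2⟩⟩
  · exact ⟨⟨bl.x, bl.y + h, bl.z + h⟩, by simp [kids], ⟨h0l, a0⟩,
      ⟨by push_cast; linarith, by push_cast; linarith⟩, ⟨by push_cast; linarith, by push_cast; linarith⟩⟩
  · exact ⟨⟨bl.x + h, bl.y, bl.z⟩, by simp [kids], ⟨by push_cast; linarith, by push_cast; linarith⟩,
      ⟨h1l, a1⟩, ⟨h2l, a2⟩⟩
  · exact ⟨⟨bl.x + h, bl.y, bl.z + h⟩, by simp [kids], ⟨by push_cast; linarith, by push_cast; linarith⟩,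
      ⟨h1l, a1⟩, ⟨by push_cast; linarith, by push_cast; linarith⟩⟩
  · exact ⟨⟨bl.x + h, bl.y + h, bl.z⟩, by simp [kids], ⟨by push_cast; linarith, by push_cast; linarith⟩,
      ⟨by push_cast; linarith, by push_cast; linarith⟩, ⟨h2l, a2⟩⟩
  · exact ⟨⟨bl.x + h, bl.y + h, bl.z + h⟩, by simp [kids], ⟨by push_cast; linarith, by push_cast; linarith⟩,
      ⟨by push_cast; linarith, by push_cast; linarith⟩, ⟨by push_cast; linarith, by push_cast; linarith⟩⟩

/-! ### Soundness of the octree -/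

/-- **Soundness of `coverBox`** (boxes of side divisible by `2 ^ depth`): every real point of
the box inside the shadow `63/20`-ball is within `δ` of a listed point. [folklore] -/
theorem coverBox_sound (dN : ℤ) : ∀ (d : ℕ) (pts : List V3) (bl : V3) (size : ℤ),
    (2 : ℤ) ^ d ∣ size → St.coverBox dN pts d bl size = true →
    ∀ x : E3, (((bl.x : ℝ) ≤ S * x 0 ∧ (S : ℝ) * x 0 ≤ bl.x + size) ∧
      ((bl.y : ℝ) ≤ S * x 1 ∧ (S : ℝ) * x 1 ≤ bl.y + size) ∧
      ((bl.z : ℝ) ≤ S * x 2 ∧ (S : ℝ) * x 2 ≤ bl.z + size)) →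
    400 * ((S : ℝ) ^ 2 * ‖x‖ ^ 2) ≤ 3969 * (NN2 : ℝ) →
    ∃ p ∈ pts, 1600 * ((S : ℝ) ^ 2 * ‖x - toE3 p‖ ^ 2) ≤ (dN : ℝ) * NN2 := by
  -- the two discharging tests
  have prune : ∀ (bl : V3) (size : ℤ) (x : E3),
      (((bl.x : ℝ) ≤ S * x 0 ∧ (S : ℝ) * x 0 ≤ bl.x + size) ∧
        ((bl.y : ℝ) ≤ S * x 1 ∧ (S : ℝ) * x 1 ≤ bl.y + size) ∧
        ((bl.z : ℝ) ≤ S * x 2 ∧ (S : ℝ) * x 2 ≤ bl.z + size)) →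
      400 * ((S : ℝ) ^ 2 * ‖x‖ ^ 2) ≤ 3969 * (NN2 : ℝ) →
      ¬ (3969 * NN2 < 400 * boxDistSq bl size) := by
    intro bl size x hx hball hlt
    have h1 := boxDistSq_le hx
    have h2 : ((3969 * NN2 : ℤ) : ℝ) < ((400 * boxDistSq bl size : ℤ) : ℝ) := by exact_mod_cast hlt
    push_cast at h2
    linarith
  have accept : ∀ (pts : List V3) (bl : V3) (size : ℤ) (x : E3),
      (((bl.x : ℝ) ≤ S * x 0 ∧ (S : ℝ) * x 0 ≤ bl.x + size) ∧
        ((bl.y : ℝ) ≤ S * x 1 ∧ (S : ℝ) * x 1 ≤ bl.y + size) ∧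
        ((bl.z : ℝ) ≤ S * x 2 ∧ (S : ℝ) * x 2 ≤ bl.z + size)) →
      pts.any (fun p => decide (1600 * distSqFar p bl size ≤ dN * NN2)) = true →
      ∃ p ∈ pts, 1600 * ((S : ℝ) ^ 2 * ‖x - toE3 p‖ ^ 2) ≤ (dN : ℝ) * NN2 := by
    intro pts bl size x hx hany
    obtain ⟨p, hp, hle⟩ := List.any_eq_true.1 hany
    have hle' : 1600 * distSqFar p bl size ≤ dN * NN2 := of_decide_eq_true hle
    refine ⟨p, hp, ?_⟩
    have h1 := norm_sub_toE3_sq_le hx p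
    have h2 : ((1600 * distSqFar p bl size : ℤ) : ℝ) ≤ ((dN * NN2 : ℤ) : ℝ) := by exact_mod_cast hle'
    push_cast at h2
    linarith
  intro d
  induction d with
  | zero =>
    intro pts bl size _ h x hx hball
    rw [St.coverBox, Bool.or_eq_true, decide_eq_true_eq] at h
    rcases h with h | h
    · exact absurd h (prune bl size x hx hball)
    · exact accept pts bl size x hx h
  | succ d ih =>
    intro pts bl size hdvd h x hx hball
    rw [St.coverBox] at h
    split_ifs at h with hp ha
    · exact absurd hp (prune bl size x hx hball)
    · exact accept pts bl size x hx ha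
    · -- descend into the half containing `x`
      have h2 : (2 : ℤ) ∣ size := (dvd_pow_self 2 (Nat.succ_ne_zero d)).trans hdvd
      have hsz : size = 2 * (size / 2) := (Int.mul_ediv_cancel' h2).symm
      have hdvd' : (2 : ℤ) ^ d ∣ size / 2 := by
        obtain ⟨m, hm⟩ := hdvd
        refine ⟨m, ?_⟩
        rw [hm, pow_succ]
        rw [show (2 : ℤ) ^ d * 2 * m = 2 * (2 ^ d * m) by ring, Int.mul_ediv_cancel_left _ two_ne_zero]
      rw [hsz] at hx
      obtain ⟨c, hc, hxc⟩ := exists_mem_kids hx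
      rw [List.all_eq_true] at h
      have hcov := h c hc
      obtain ⟨p, hp, hle⟩ := ih _ c (size / 2) hdvd' hcov x hxc hball
      exact ⟨p, List.mem_of_mem_filter hp, hle⟩

/-- **Soundness of the cover check of a state** (depth `≤ 15`): every point of the shadow
`63/20`-ball (`400 S² ‖x‖² ≤ 3969 NN2`) is within `δ` of the position of a site of the state of
shadow radius `≤ R`. [folklore] -/
theorem coverCheck_sound {dN Rk : ℤ} {depth : ℕ} (hdepth : depth ≤ 15) {s : St}
    (h : St.coverCheck dN Rk depth s = true) (x : E3)
    (hball : 400 * ((S : ℝ) ^ 2 * ‖x‖ ^ 2) ≤ 3969 * (NN2 : ℝ)) :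
    ∃ a, a < s.size ∧ 100 * V3.n2 (s.pos a) ≤ Rk * NN2 ∧
      1600 * ((S : ℝ) ^ 2 * ‖x - toE3 (s.pos a)‖ ^ 2) ≤ (dN : ℝ) * NN2 := by
  have hdvd : (2 : ℤ) ^ depth ∣ 32768 := by
    rw [show (32768 : ℤ) = 2 ^ 15 by norm_num]
    exact pow_dvd_pow 2 hdepth
  -- the ball lies in the root box
  have hcoord : ∀ t : Fin 3, ((-16384 : ℤ) : ℝ) ≤ S * x t ∧ (S : ℝ) * x t ≤ (-16384 : ℤ) + (32768 : ℤ) := by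
    intro t
    have h1 : ((S : ℝ) * x t) ^ 2 ≤ (S : ℝ) ^ 2 * ‖x‖ ^ 2 := by
      rw [mul_pow]
      refine mul_le_mul_of_nonneg_left ?_ (sq_nonneg _)
      rw [EuclideanSpace.real_norm_sq_eq]
      exact Finset.single_le_sum (f := fun i => x i ^ 2) (fun i _ => sq_nonneg (x i))
        (Finset.mem_univ t) |>.trans' (by simp)
    have hN : (NN2 : ℝ) = 2 * 2187 ^ 2 := by simp [NN2, S]; ring
    rw [hN] at hball
    have h2 : ((S : ℝ) * x t) ^ 2 ≤ 16384 ^ 2 := by nlinarith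
    have h3 := abs_le_of_sq_le_sq' h2 (by norm_num)
    push_cast
    constructor <;> linarith [h3.1, h3.2]
  obtain ⟨p, hp, hle⟩ := coverBox_sound dN depth _ _ _ hdvd h x ⟨hcoord 0, hcoord 1, hcoord 2⟩ hball
  obtain ⟨a, ha, rfl⟩ := List.mem_map.1 hp
  rw [List.mem_filter, List.mem_range, decide_eq_true_eq] at ha
  exact ⟨a, ha.1, ha.2, hle⟩

/-! ### Soundness of the cover search and of its parts -/

variable (A : Dev)

/-- **Soundness of the cover search**: for a realized state, `searchCover = true` (depth `≤ 15`)
gives the COVER CONCLUSION in the shadow frame (`nn² = 2`): every `x` with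
`‖x‖² ≤ 2 (63/20)²` is within `√(dN/800)` of the shadow of a graph-`5`-ball site whose shadow has
`‖·‖² ≤ Rk / 50`. [folklore] -/
theorem searchCover_sound {dN Rk : ℤ} {depth : ℕ} (hdepth : depth ≤ 15) :
    ∀ (fuel : ℕ) (s : St) (emb : ℕ → Fin A.N), RealizedBy A s emb →
    St.searchCover dN Rk depth TABLE fuel s = true →
    ∀ x : E3, ‖x‖ ^ 2 ≤ 2 * (63 / 20) ^ 2 →
      ∃ j, (∃ w : A.G.Walk A.i j, w.length ≤ 5) ∧ ‖A.pos j‖ ^ 2 ≤ Rk / 50 ∧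
        ‖x - A.pos j‖ ^ 2 ≤ dN / 800 := by
  intro fuel
  induction fuel with
  | zero => intro s emb _ h; simp [St.searchCover] at h
  | succ fuel ih =>
    intro s emb hR h
    rw [St.searchCover] at h
    split_ifs at h with hc
    · cases ho : s.options TABLE with
      | none => rw [ho] at h; exact Bool.noConfusion h
      | some opts =>
        rw [ho] at h
        simp only [List.all_eq_true] at h
        obtain ⟨s', hs', emb', ⟨hR'⟩⟩ := options_sound hR hc.1 hc.2 ho
        exact ih s' emb' hR' (h s' hs')
    · -- a leaf: every site of the state is a graph-`5`-ball site at its recorded position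
      intro x hx
      have hS := S_real.2
      have hN : (NN2 : ℝ) = 2 * (S : ℝ) ^ 2 := by simp [NN2]; ring
      have hball : 400 * ((S : ℝ) ^ 2 * ‖x‖ ^ 2) ≤ 3969 * (NN2 : ℝ) := by rw [hN]; nlinarith
      obtain ⟨a, ha, hR', hle⟩ := coverCheck_sound hdepth h x hball
      refine ⟨emb a, A.ball_mono (hR.lvl5 a ha) (hR.lvlE a ha), ?_, ?_⟩
      · rw [hR.posE a ha, norm_toE3_sq, div_le_div_iff₀ (pow_pos hS 2) (by norm_num : (0 : ℝ) < 50)]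
        have : ((100 * V3.n2 (s.pos a) : ℤ) : ℝ) ≤ ((Rk * NN2 : ℤ) : ℝ) := by exact_mod_cast hR'
        push_cast at this
        rw [hN] at this
        linarith
      · rw [hR.posE a ha]
        rw [hN] at hle
        have hS2 : (0 : ℝ) < (S : ℝ) ^ 2 := pow_pos hS 2
        rw [le_div_iff₀ (by norm_num : (0 : ℝ) < 800)]
        nlinarith

/-- **Soundness of the parts of the cover search**: if every part returns `true` (frontier depth
`d ≤ 5`, octree depth `≤ 15`, `parts > 0`), every development satisfies the cover conclusion.
[folklore] -/
theorem partsCover_sound {dN Rk : ℤ} {depth d parts fuel : ℕ} (hdepth : depth ≤ 15) (hd : d ≤ 5)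
    (hp : 0 < parts) (h : ∀ idx, idx < parts → St.partCover dN Rk depth d parts idx fuel = true) :
    ∀ x : E3, ‖x‖ ^ 2 ≤ 2 * (63 / 20) ^ 2 →
      ∃ j, (∃ w : A.G.Walk A.i j, w.length ≤ 5) ∧ ‖A.pos j‖ ^ 2 ≤ Rk / 50 ∧
        ‖x - A.pos j‖ ^ 2 ≤ dN / 800 := by
  have h0 := h 0 hp
  cases hfr : St.frontier TABLE 4000 d St.root with
  | none => simp [St.partCover, hfr] at h0
  | some fr =>
    obtain ⟨s', hs', emb', ⟨hR'⟩⟩ :=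
      frontier_sound A hd 4000 St.root (fun _ => A.i) (realizedByRoot A) fr hfr
    obtain ⟨t, ht, rfl⟩ := List.mem_iff_getElem.1 hs'
    have hpart := h (t % parts) (Nat.mod_lt t hp)
    simp only [St.partCover, hfr, List.all_eq_true, List.mem_filter, List.mem_range,
      decide_eq_true_eq] at hpart
    have := hpart t ⟨ht, rfl⟩
    rw [List.getElem?_eq_getElem ht] at this
    exact searchCover_sound A hdepth fuel _ emb' hR' this

/-! ### Back to the shadow space of `D` -/

open Literature.Geometry.DiscreteGeometry in
/-- **The cover conclusion for the hypotheses of the stub.**  If every part of the cover search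
returns `true` (octree depth `≤ 15`, frontier depth `≤ 5`), then for the development `D` of
`H : Hyp` every point `x` of shadow space with `‖x - D i‖ ≤ 63/20` is within `δ` of `D v` for some
site `v` of the graph `5`-ball with `dist (D v) (D i) ≤ R` (`1600 δ² = dN`, `100 R² = Rk`).
[folklore] -/
theorem Hyp.cover_of_parts (H : Hyp) {dN Rk : ℤ} {depth d parts fuel : ℕ} (hdepth : depth ≤ 15)
    (hd : d ≤ 5) (hp : 0 < parts)
    (h : ∀ idx, idx < parts → St.partCover dN Rk depth d parts idx fuel = true)
    (x : E3) (hx : ‖x - H.D H.i‖ ≤ 63 / 20) :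
    ∃ v, (∃ w : (bondGraph H.η H.y).Walk H.i v, w.length ≤ 5) ∧
      dist (H.D v) (H.D H.i) ^ 2 ≤ Rk / 100 ∧ ‖x - H.D v‖ ^ 2 ≤ dN / 1600 := by
  set x' : E3 := Real.sqrt 2 • H.rootQ.symm (x - H.D H.i) with hx'
  have h2 : Real.sqrt 2 ^ 2 = 2 := Real.sq_sqrt (by norm_num)
  have hn' : ‖x'‖ ^ 2 = 2 * ‖x - H.D H.i‖ ^ 2 := by
    rw [hx', norm_smul, Real.norm_of_nonneg (Real.sqrt_nonneg 2), LinearIsometryEquiv.norm_map,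
      mul_pow, h2]
  have hball : ‖x'‖ ^ 2 ≤ 2 * (63 / 20) ^ 2 := by
    rw [hn']; nlinarith [norm_nonneg (x - H.D H.i)]
  obtain ⟨j, hw, hR, hδ⟩ := partsCover_sound H.dev hdepth hd hp h x' hball
  refine ⟨j, hw, ?_, ?_⟩
  · have e := H.norm_pos j
    change ‖H.pos j‖ ^ 2 ≤ Rk / 50 at hR
    rw [e] at hR
    linarith
  · have e : x' - H.pos j = Real.sqrt 2 • H.rootQ.symm (x - H.D j) := by
      simp only [hx', Hyp.pos, ← smul_sub, ← map_sub]
      congr 2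
      abel
    change ‖x' - H.pos j‖ ^ 2 ≤ dN / 800 at hδ
    rw [e, norm_smul, Real.norm_of_nonneg (Real.sqrt_nonneg 2), LinearIsometryEquiv.norm_map,
      mul_pow, h2] at hδ
    linarith

end OneStacking

end Summit.AtomisticToContinuum.Crystallization.Theorems
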